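import Literature.NumberTheory.Sieve.HardyLittlewoodChowla
import Literature.NumberTheory.Sieve.HardyLittlewoodChowlaAssembly
import Literature.NumberTheory.Sieve.HardyLittlewoodChowlaMomentBound
import HarnessLib

/-!
# Hardy–Littlewood–Chowla on average (Lichtman–Teräväinen 2022): the discharges

Topic `Literature/NumberTheory/Sieve`.  Discharges of the two named facts of
`HardyLittlewoodChowla.lean`:

* `lichtmanTeravainen2022_hlc_avg_holds : lichtmanTeravainen2022_hlc_avg` — J. D. Lichtman,
  J. Teräväinen, *On the Hardy–Littlewood–Chowla conjecture on average*, Forum Math. Sigma 10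
  (2022) e57, doi:10.1017/fms.2022.54, arXiv:2111.08912, **Theorem 1.2 (i)** (p. 3) for the Möbius
  function;
* `lichtmanTeravainen2022_hlc_avg_liouville_holds : lichtmanTeravainen2022_hlc_avg_liouville` —
  the same for the Liouville function ("As is clear from the proof, Theorem 1.2 holds equally well
  with the Liouville function in place of the Möbius function", loc. cit.).

Both are `hlc_avg_{moebius,liouville}_of_moments` (§4 of the paper,
`HardyLittlewoodChowlaAssembly.lean`: Proposition 3.2 = `holder_fourier_bound`, Proposition 2.1 =
`moebius_typ_window_sq_le` / `liouville_typ_window_sq_le` from [MRT2015, Theorem 2.3] and the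
Vinogradov–Korobov non-pretentiousness of `μ`, `λ`, Lemmas 2.3–2.5, 2.11 =
`HardyLittlewoodChowlaSieve.lean`, `HardyLittlewoodChowlaSingular.lean`) fed with Proposition 2.7 =
`moment_bound` (`HardyLittlewoodChowlaMomentBound.lean`, on `HardyLittlewoodChowlaMomentsPrep.lean`
and `HardyLittlewoodChowlaTuples.lean`).  This file introduces no definition and no named fact.

## References

* J. D. Lichtman, J. Teräväinen, Forum Math. Sigma 10 (2022) e57, arXiv:2111.08912, Theorem 1.2 (i)
  and §§2–4. [cite: LichtmanTeravainen2022, Theorem 1.2 (i) (p. 3)]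
* K. Matomäki, M. Radziwiłł, T. Tao, Algebra Number Theory 9 (2015) 2167–2196, Theorem 2.3.
  [cite: MatomakiRadziwillTao2015, Theorem 2.3]
-/

noncomputable section

open Finset

namespace Literature.NumberTheory.Sieve

/-- **Theorem 1.2 (i) of [LichtmanTeravainen2022] (Möbius)**: the named fact
`lichtmanTeravainen2022_hlc_avg` holds. [cite: LichtmanTeravainen2022, Theorem 1.2 (i) (p. 3)] -/
theorem lichtmanTeravainen2022_hlc_avg_holds : lichtmanTeravainen2022_hlc_avg := by
  unfold lichtmanTeravainen2022_hlc_avg hlcMoebiusSum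
  exact LichtmanTeravainen2022.hlc_avg_moebius_of_moments LichtmanTeravainen2022.moment_bound

/-- **Theorem 1.2 (i) of [LichtmanTeravainen2022] (Liouville)**: the named fact
`lichtmanTeravainen2022_hlc_avg_liouville` holds.
[cite: LichtmanTeravainen2022, Theorem 1.2 (i) (p. 3) and the remark following Theorem 1.2] -/
theorem lichtmanTeravainen2022_hlc_avg_liouville_holds : lichtmanTeravainen2022_hlc_avg_liouville := by
  unfold lichtmanTeravainen2022_hlc_avg_liouville hlcLiouvilleSum
  exact LichtmanTeravainen2022.hlc_avg_liouville_of_moments LichtmanTeravainen2022.moment_bound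

end Literature.NumberTheory.Sieve
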